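import Mathlib
import HarnessLib
import Summits.Ventures.LatticeQCDFlow.Scoring.DoeblinThinning
import Summits.Ventures.LatticeQCDFlow.Scoring.DoeblinEnvelopeSharp

/-!
# The `k`-step minorisation constant `1 − (1 − ε)^k` is attained: the `k`-step kernel of the lazy
# kernel `ε π + (1 − ε) δ_x` is the lazy kernel `ε_k π + (1 − ε_k) δ_x`

HONEST FRAMING: exact (Metropolis-corrected) sampling algorithms for lattice gauge theory;
figures of merit are autocorrelation/cost numbers at stated couplings and volumes; no
continuum-physics claim.

Venture `LatticeQCDFlow` (cell pub-lqcd), topic `Scoring`; FANOUT row 8 (`s0-cpn-nemc`, GEN-14).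
NEW WORK of the cell (elementary), not a published result; no definition is introduced.  Companion
(sharpness) of `Scoring/DoeblinThinning.lean` (`doeblin_nHit_of_doeblin`: `κ ≥ ε π`, `π` invariant
⇒ `κ^k ≥ (1 − (1 − ε)^k) π`), on the lazy kernel of `Scoring/DoeblinEnvelopeSharp.lean` (which
already attains the one-step envelope and `τ_int = 1/ε − 1/2`): its `k`-step kernel is computed in
closed form, so no constant larger than `ε_k = 1 − (1 − ε)^k` minorises `κ^k` by `π` as soon as `π`
charges a set missing some point.  Inputs: Mathlib's `Measure.bind` calculus (`dirac_bind`,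
`bind_smul`), `lazy_invariant`, row 9's `nHit`.  Nothing is cited as a fact.

## Content (`κ(x, ·) = ε π + (1 − ε) δ_x`, `ε ≤ 1`)

* `bind_add_measure` — `(μ + ν).bind κ = μ.bind κ + ν.bind κ`;
* **`lazy_nHit_apply`** — `(nHit κ k) x = (1 − (1 − ε)^k) • π + (1 − ε)^k • δ_x` for all `k`, `x`;
* **`lazy_nHit_apply_of_not_mem`** — `x ∉ B` measurable ⇒ `κ^k(x, B) = (1 − (1 − ε)^k) π(B)`;
* **`le_eps_nHit_of_minorised_lazy`** — if `c π(B) ≤ κ^k(x, B)` for some measurable `B ∌ x` with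
  `0 < π(B)`, then `c ≤ 1 − (1 − ε)^k`: the constant of `doeblin_nHit_of_doeblin` cannot be improved
  as a function of `ε` and `k` alone.

NOT CLAIMED: anything about concrete samplers; any number of ours.
-/

noncomputable section

namespace Summit.Ventures.LatticeQCDFlow.Scoring

open MeasureTheory ProbabilityTheory Filter Summit.Ventures.LatticeQCDFlow.Exactness
open scoped ENNReal

variable {Ω : Type*} [MeasurableSpace Ω]

/-- `bind` is additive in the measure. -/
theorem bind_add_measure (μ ν : Measure Ω) (κ : Kernel Ω Ω) :
    (μ + ν).bind κ = μ.bind κ + ν.bind κ := by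
  ext A hA
  rw [Measure.bind_apply hA (Kernel.aemeasurable κ), Measure.add_apply,
    Measure.bind_apply hA (Kernel.aemeasurable κ), Measure.bind_apply hA (Kernel.aemeasurable κ),
    lintegral_add_measure]

section Lazy

variable {κ : Kernel Ω Ω} {π : Measure Ω} [IsProbabilityMeasure π] {ε : ℝ≥0∞}

omit [MeasurableSpace Ω] [IsProbabilityMeasure π] in
/-- `(1 − (1 − ε)^k) + (1 − ε)^k ε = 1 − (1 − ε)^{k+1}` in `ℝ≥0∞`, for `ε ≤ 1`. -/
theorem one_sub_pow_add_pow_mul (ε : ℝ≥0∞) (hε1 : ε ≤ 1) (k : ℕ) :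
    (1 - (1 - ε) ^ k) + (1 - ε) ^ k * ε = 1 - (1 - ε) ^ (k + 1) := by
  set a : ℝ≥0∞ := 1 - ε with ha
  have hatop : a ≠ ⊤ := ne_top_of_le_ne_top ENNReal.one_ne_top tsub_le_self
  have ha1 : a ≤ 1 := tsub_le_self
  have hak1 : a ^ k ≤ 1 := pow_le_one₀ zero_le ha1
  have hakk : a ^ (k + 1) ≤ a ^ k := by
    rw [pow_succ]
    calc a ^ k * a ≤ a ^ k * 1 := by gcongr
      _ = a ^ k := mul_one _
  have hεa : ε = 1 - a := by rw [ha]; exact (ENNReal.sub_sub_cancel ENNReal.one_ne_top hε1).symm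
  have h1 : a ^ k * ε = a ^ k - a ^ (k + 1) := by
    rw [hεa, ENNReal.mul_sub (fun _ _ => ENNReal.pow_ne_top hatop), mul_one, ← pow_succ]
  rw [h1, tsub_add_tsub_cancel hak1 hakk]

/-- **The `k`-step kernel of a lazy kernel is lazy with constant `ε_k = 1 − (1 − ε)^k`:**
`(nHit κ k) x = (1 − (1 − ε)^k) • π + (1 − ε)^k • δ_x`. -/
theorem lazy_nHit_apply (hκ : ∀ x, κ x = ε • π + (1 - ε) • Measure.dirac x) (hε1 : ε ≤ 1) :
    ∀ (k : ℕ) (x : Ω), nHit κ k x = (1 - (1 - ε) ^ k) • π + (1 - ε) ^ k • Measure.dirac x := by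
  have hinv := lazy_invariant hκ hε1
  haveI := lazy_isMarkovKernel hκ hε1
  intro k
  induction k with
  | zero => intro x; simp [nHit_zero, Kernel.id_apply]
  | succ k ih =>
    intro x
    haveI := isMarkovKernel_nHit κ k
    ext A hA
    have hmeasA : Measurable fun y => κ y A := Kernel.measurable_coe κ hA
    have hπA : ∫⁻ y, κ y A ∂π = π A := by
      rw [← Measure.bind_apply hA (Kernel.aemeasurable κ)]
      exact congrArg (fun m : Measure Ω => m A) hinv.def
    have hκxA : κ x A = ε * π A + (1 - ε) * A.indicator 1 x := by
      rw [hκ x, Measure.add_apply, Measure.smul_apply, Measure.smul_apply, smul_eq_mul, smul_eq_mul,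
        Measure.dirac_apply' x hA]
    rw [nHit_succ, Kernel.comp_apply' _ _ _ hA, ih x, lintegral_add_measure, lintegral_smul_measure,
      lintegral_smul_measure, lintegral_dirac' _ hmeasA, hπA, hκxA, Measure.add_apply,
      Measure.smul_apply, Measure.smul_apply, smul_eq_mul, smul_eq_mul, smul_eq_mul, smul_eq_mul,
      Measure.dirac_apply' x hA, ← one_sub_pow_add_pow_mul ε hε1 k]
    ring

/-- **Off the current point the `k`-step kernel is exactly `ε_k π`**: for measurable `B` with
`x ∉ B`, `κ^k(x, B) = (1 − (1 − ε)^k) π(B)`. -/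
theorem lazy_nHit_apply_of_not_mem (hκ : ∀ x, κ x = ε • π + (1 - ε) • Measure.dirac x)
    (hε1 : ε ≤ 1) (k : ℕ) {x : Ω} {B : Set Ω} (hB : MeasurableSet B) (hxB : x ∉ B) :
    nHit κ k x B = (1 - (1 - ε) ^ k) * π B := by
  rw [lazy_nHit_apply hκ hε1 k x, Measure.add_apply, Measure.smul_apply, Measure.smul_apply,
    smul_eq_mul, smul_eq_mul, Measure.dirac_apply' x hB, Set.indicator_of_notMem hxB, mul_zero,
    add_zero]

/-- **THE THINNING CONSTANT IS SHARP.**  If `c π(B) ≤ κ^k(x, B)` for a lazy kernel, some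
measurable `B` with `x ∉ B` and `0 < π(B)`, then `c ≤ 1 − (1 − ε)^k`: no function of `ε` and `k`
alone improves `doeblin_nHit_of_doeblin`. -/
theorem le_eps_nHit_of_minorised_lazy (hκ : ∀ x, κ x = ε • π + (1 - ε) • Measure.dirac x)
    (hε1 : ε ≤ 1) (k : ℕ) {c : ℝ≥0∞} {x : Ω} {B : Set Ω} (hB : MeasurableSet B) (hxB : x ∉ B)
    (hπB : 0 < π B) (hc : c * π B ≤ nHit κ k x B) : c ≤ 1 - (1 - ε) ^ k := by
  rw [lazy_nHit_apply_of_not_mem hκ hε1 k hB hxB] at hc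
  exact (ENNReal.mul_le_mul_iff_left hπB.ne' (measure_ne_top π B)).1 hc

end Lazy

end Summit.Ventures.LatticeQCDFlow.Scoring

end
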